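import Mathlib.Topology.MetricSpace.HausdorffDimension
import Mathlib.Geometry.Manifold.ChartedSpace
import Mathlib.Analysis.Calculus.ContDiff.RCLike
import Mathlib.LinearAlgebra.Complex.FiniteDimensional
import Literature.Topology.Euclidean.InvarianceOfDimension
import Literature.Analysis.Complex.OsgoodProofs
import HarnessLib

/-!
# A `C¹` (or holomorphic) injection whose image has non-empty interior preserves the dimension

**Theorem** (folklore; Brouwer 1911 + the Lipschitz bound on Hausdorff dimension). Let `E`, `F` be
finite-dimensional real normed spaces, `U ⊆ E` open, and `f : E → F` of class `C¹` on `U`.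
(a) The image `f(U)` has Hausdorff dimension `≤ dim E`; hence if `f(U)` has NON-EMPTY INTERIOR then
`dim F ≤ dim E` (a `C¹` map cannot fill an open set of a bigger space — the easy half of Sard).
(b) If moreover `f` is injective on `U`, then `dim E ≤ dim F` (Brouwer's invariance of dimension,
the tree's `Brouwer.finrank_le_of_injOn_of_isOpen`), so `dim E = dim F`.
The same for complex normed spaces and holomorphic (`DifferentiableOn ℂ`, via the tree's Osgood
lemma) maps, with `finrank ℂ`; and the CHARTWISE form for a second-countable space `M` charted on
`E` and a map `f : M → F` that is `C¹` in every chart: `range f` with non-empty interior forces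
`dim F ≤ dim E`, injectivity + continuity force `dim E ≤ dim F`.

Consumer (cell hodgecm-mathlib, U-DAG §2 node U-e P5, B-plan2 (g9) R79): the equal-dimension step
of the period map of the universal family over the Siegel fine moduli scheme — a holomorphic
BIJECTION from a piece `S_c(ℂ)` (charted on `ℂ^d`) onto `Γ_δ(N)∖𝔥_g` forces `d = g(g+1)/2`, after
which invariance of domain (`Brouwer.isOpen_image_of_injOn`) and Clements–Osgood apply; generic, no
Siegel tokens here.

Main results (namespace `Literature.Topology.Euclidean`):

* `dimH_image_le_finrank_of_contDiffOn` — `dimH (f '' U) ≤ finrank ℝ E` for `f` `C¹` on the open `U`;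
* `finrank_le_of_contDiffOn_of_nonempty_interior` — `(interior (f '' U)).Nonempty ⇒ finrank ℝ F ≤ finrank ℝ E`;
* `finrank_eq_of_injOn_of_contDiffOn_of_nonempty_interior` — with `InjOn f U`: `finrank ℝ E = finrank ℝ F`;
* `finrank_le_of_contDiff_of_nonempty_interior_range`, `finrank_eq_of_injective_of_contDiff_of_nonempty_interior_range`
  — global (`ContDiff ℝ 1`) forms;
* `finrank_complex_le_of_contDiffOn_of_nonempty_interior`, `finrank_complex_eq_of_injOn_of_contDiffOn_of_nonempty_interior`,
  `finrank_complex_eq_of_injOn_of_differentiableOn_of_nonempty_interior` — complex forms (`finrank ℂ`; the last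
  for HOLOMORPHIC `f`, `DifferentiableOn ℂ f U`, through Osgood's lemma `SCV.analyticOnNhd_of_differentiableOn`);
* `dimH_range_le_finrank_of_chartwise_contDiffOn`, `finrank_le_of_chartwise_contDiffOn_of_nonempty_interior_range`,
  `finrank_le_of_injective_of_continuous_charted`, `finrank_eq_of_injective_of_chartwise_contDiffOn_of_nonempty_interior_range`
  — the chartwise forms for `M` second countable, `ChartedSpace E M`.

No definitions. Mathlib (v4.32.0) has the Hausdorff-dimension bounds (`ContDiffOn.dimH_image_le`,
`dimH_image_le_of_locally_lipschitzOn`, `Real.dimH_of_nonempty_interior`) but neither invariance of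
domain/dimension nor these packaged equalities.

## References

* L. E. J. Brouwer, *Beweis der Invarianz der Dimensionenzahl*, Math. Ann. 70 (1911), 161–165 [Brouwer1911Dimension].
* T. Tao, *Hilbert's Fifth Problem and Related Topics*, GSM 153 (2014), §6.2 [Tao2014].
* P. Mattila, *Geometry of Sets and Measures in Euclidean Spaces*, CUP (1995), Thm. 7.5 (Lipschitz maps do
  not increase Hausdorff dimension) [Mattila1995].
-/

open Set Filter Topology Module
open scoped ENNReal NNReal

namespace Literature.Topology.Euclidean

/-! ### Real normed spaces: the `C¹` image bound and the dimension equality -/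

section Real

variable {E F : Type*} [NormedAddCommGroup E] [NormedSpace ℝ E] [FiniteDimensional ℝ E]
  [NormedAddCommGroup F] [NormedSpace ℝ F] [FiniteDimensional ℝ F]

omit [FiniteDimensional ℝ F] in
/-- **A `C¹` image has Hausdorff dimension at most the dimension of the source**: for `U ⊆ E` open and
`f` of class `C¹` on `U`, `dimH (f '' U) ≤ finrank ℝ E` (`C¹` maps are locally Lipschitz, and locally
Lipschitz maps do not increase Hausdorff dimension — Mathlib `dimH_image_le_of_locally_lipschitzOn`).
[cite: Mattila1995, Thm. 7.5] -/
theorem dimH_image_le_finrank_of_contDiffOn {f : E → F} {U : Set E} (hU : IsOpen U)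
    (hf : ContDiffOn ℝ 1 f U) : dimH (f '' U) ≤ finrank ℝ E := by
  have hlip : ∀ x ∈ U, ∃ C : ℝ≥0, ∃ t ∈ 𝓝[U] x, LipschitzOnWith C f t := by
    intro x hx
    obtain ⟨K, t, ht, hK⟩ := (hf.contDiffAt (hU.mem_nhds hx)).exists_lipschitzOnWith
    exact ⟨K, t, mem_nhdsWithin_of_mem_nhds ht, hK⟩
  calc dimH (f '' U) ≤ dimH U := dimH_image_le_of_locally_lipschitzOn hlip
    _ ≤ dimH (univ : Set E) := dimH_mono (subset_univ _)
    _ = finrank ℝ E := Real.dimH_univ_eq_finrank E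

/-- **A `C¹` map cannot fill an open set of a bigger space**: if `f` is `C¹` on the open `U ⊆ E` and
`f '' U` has non-empty interior in `F`, then `finrank ℝ F ≤ finrank ℝ E` (the interior gives
`dimH (f '' U) = finrank ℝ F`, Mathlib `Real.dimH_of_nonempty_interior`). [cite: Mattila1995, Thm. 7.5] -/
theorem finrank_le_of_contDiffOn_of_nonempty_interior {f : E → F} {U : Set E} (hU : IsOpen U)
    (hf : ContDiffOn ℝ 1 f U) (hint : (interior (f '' U)).Nonempty) :
    finrank ℝ F ≤ finrank ℝ E := by
  have h := dimH_image_le_finrank_of_contDiffOn hU hf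
  rw [Real.dimH_of_nonempty_interior hint] at h
  exact_mod_cast h

/-- **A `C¹` injection whose image has non-empty interior preserves the dimension**: `U ⊆ E` open,
`f` `C¹` and injective on `U`, `f '' U` with non-empty interior ⇒ `finrank ℝ E = finrank ℝ F`
(`≤` is Brouwer's invariance of dimension `Brouwer.finrank_le_of_injOn_of_isOpen`, `≥` is
`finrank_le_of_contDiffOn_of_nonempty_interior`). [cite: Brouwer1911Dimension, Satz 1 (p. 161)]
[cite: Mattila1995, Thm. 7.5] -/
theorem finrank_eq_of_injOn_of_contDiffOn_of_nonempty_interior {f : E → F} {U : Set E}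
    (hU : IsOpen U) (hf : ContDiffOn ℝ 1 f U) (hinj : InjOn f U)
    (hint : (interior (f '' U)).Nonempty) : finrank ℝ E = finrank ℝ F := by
  have hne : U.Nonempty := (hint.mono interior_subset).of_image
  exact le_antisymm (Brouwer.finrank_le_of_injOn_of_isOpen hU hne hf.continuousOn hinj)
    (finrank_le_of_contDiffOn_of_nonempty_interior hU hf hint)

/-- Global form: a `C¹` map `f : E → F` whose range has non-empty interior forces
`finrank ℝ F ≤ finrank ℝ E`. [cite: Mattila1995, Thm. 7.5] -/
theorem finrank_le_of_contDiff_of_nonempty_interior_range {f : E → F} (hf : ContDiff ℝ 1 f)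
    (hint : (interior (range f)).Nonempty) : finrank ℝ F ≤ finrank ℝ E := by
  rw [← image_univ] at hint
  exact finrank_le_of_contDiffOn_of_nonempty_interior isOpen_univ hf.contDiffOn hint

/-- Global form: an injective `C¹` map `f : E → F` whose range has non-empty interior forces
`finrank ℝ E = finrank ℝ F`. [cite: Brouwer1911Dimension, Satz 1 (p. 161)] [cite: Mattila1995, Thm. 7.5] -/
theorem finrank_eq_of_injective_of_contDiff_of_nonempty_interior_range {f : E → F}
    (hf : ContDiff ℝ 1 f) (hinj : Function.Injective f) (hint : (interior (range f)).Nonempty) :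
    finrank ℝ E = finrank ℝ F := by
  rw [← image_univ] at hint
  exact finrank_eq_of_injOn_of_contDiffOn_of_nonempty_interior isOpen_univ hf.contDiffOn
    hinj.injOn hint

end Real

/-! ### Complex normed spaces and holomorphic maps -/

section Complex

variable {E F : Type*} [NormedAddCommGroup E] [NormedSpace ℂ E] [FiniteDimensional ℂ E]
  [NormedAddCommGroup F] [NormedSpace ℂ F] [FiniteDimensional ℂ F]

/-- Complex form of `finrank_le_of_contDiffOn_of_nonempty_interior`: `f` of class `C¹` over `ℂ` on the
open `U ⊆ E` with `f '' U` of non-empty interior ⇒ `finrank ℂ F ≤ finrank ℂ E` (restrict scalars to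
`ℝ`; `finrank ℝ = 2 · finrank ℂ`). [cite: Mattila1995, Thm. 7.5] -/
theorem finrank_complex_le_of_contDiffOn_of_nonempty_interior {f : E → F} {U : Set E}
    (hU : IsOpen U) (hf : ContDiffOn ℂ 1 f U) (hint : (interior (f '' U)).Nonempty) :
    finrank ℂ F ≤ finrank ℂ E := by
  haveI : FiniteDimensional ℝ E := Module.Finite.trans ℂ E
  haveI : FiniteDimensional ℝ F := Module.Finite.trans ℂ F
  have h := finrank_le_of_contDiffOn_of_nonempty_interior hU (hf.restrict_scalars ℝ) hint
  rw [finrank_real_of_complex, finrank_real_of_complex] at h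
  omega

/-- Complex form of the dimension equality: `f` of class `C¹` over `ℂ` and injective on the open
`U ⊆ E`, `f '' U` of non-empty interior ⇒ `finrank ℂ E = finrank ℂ F`.
[cite: Brouwer1911Dimension, Satz 1 (p. 161)] [cite: Mattila1995, Thm. 7.5] -/
theorem finrank_complex_eq_of_injOn_of_contDiffOn_of_nonempty_interior {f : E → F} {U : Set E}
    (hU : IsOpen U) (hf : ContDiffOn ℂ 1 f U) (hinj : InjOn f U)
    (hint : (interior (f '' U)).Nonempty) : finrank ℂ E = finrank ℂ F := by
  have hne : U.Nonempty := (hint.mono interior_subset).of_image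
  exact le_antisymm (Brouwer.finrank_complex_le_of_injOn_of_isOpen hU hne hf.continuousOn hinj)
    (finrank_complex_le_of_contDiffOn_of_nonempty_interior hU hf hint)

/-- **Holomorphic form**: `f` holomorphic (`DifferentiableOn ℂ`) and injective on the open `U ⊆ E` with
`f '' U` of non-empty interior ⇒ `finrank ℂ E = finrank ℂ F` (holomorphic on an open set of a
finite-dimensional space ⇒ analytic, the tree's Osgood lemma `SCV.analyticOnNhd_of_differentiableOn`,
hence `C¹`). [cite: Brouwer1911Dimension, Satz 1 (p. 161)] [cite: HormanderSCV1973, Thm 2.2.1 and Thm 2.2.6] -/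
theorem finrank_complex_eq_of_injOn_of_differentiableOn_of_nonempty_interior {f : E → F} {U : Set E}
    (hU : IsOpen U) (hf : DifferentiableOn ℂ f U) (hinj : InjOn f U)
    (hint : (interior (f '' U)).Nonempty) : finrank ℂ E = finrank ℂ F := by
  haveI : CompleteSpace F := FiniteDimensional.complete ℂ F
  have han := Literature.Analysis.Complex.SCV.analyticOnNhd_of_differentiableOn hf hU
  exact finrank_complex_eq_of_injOn_of_contDiffOn_of_nonempty_interior hU (han.contDiffOn_of_completeSpace (n := 1))
    hinj hint

/-- **Holomorphic form, inequality only**: `f` holomorphic on the open `U ⊆ E` with `f '' U` of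
non-empty interior ⇒ `finrank ℂ F ≤ finrank ℂ E`. [cite: Mattila1995, Thm. 7.5] [cite: HormanderSCV1973, Thm 2.2.1 and Thm 2.2.6] -/
theorem finrank_complex_le_of_differentiableOn_of_nonempty_interior {f : E → F} {U : Set E}
    (hU : IsOpen U) (hf : DifferentiableOn ℂ f U) (hint : (interior (f '' U)).Nonempty) :
    finrank ℂ F ≤ finrank ℂ E := by
  haveI : CompleteSpace F := FiniteDimensional.complete ℂ F
  have han := Literature.Analysis.Complex.SCV.analyticOnNhd_of_differentiableOn hf hU
  exact finrank_complex_le_of_contDiffOn_of_nonempty_interior hU (han.contDiffOn_of_completeSpace (n := 1)) hint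

end Complex

/-! ### Chartwise forms on a second-countable charted space -/

section Charted

variable {E F : Type*} [NormedAddCommGroup E] [NormedSpace ℝ E] [FiniteDimensional ℝ E]
  [NormedAddCommGroup F] [NormedSpace ℝ F] [FiniteDimensional ℝ F]
  {M : Type*} [TopologicalSpace M] [ChartedSpace E M]

omit [FiniteDimensional ℝ F] in
/-- **The range of a chartwise-`C¹` map from a second-countable space charted on `E` has Hausdorff
dimension `≤ dim E`**: countably many charts cover `M` (second countability), on each the map read in
the chart is `C¹` on the open chart target, and `dimH` of a countable union is the supremum.
[cite: Mattila1995, Thm. 7.5] -/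
theorem dimH_range_le_finrank_of_chartwise_contDiffOn [SecondCountableTopology M] {f : M → F}
    (hf : ∀ x : M, ContDiffOn ℝ 1 (f ∘ (chartAt E x).symm) (chartAt E x).target) :
    dimH (range f) ≤ finrank ℝ E := by
  -- countably many chart sources cover `M`
  obtain ⟨s, hsc, hcov⟩ := TopologicalSpace.countable_cover_nhds
    (fun x : M ↦ (chartAt E x).open_source.mem_nhds (mem_chart_source E x))
  have hrange : range f ⊆ ⋃ x ∈ s, (f ∘ (chartAt E x).symm) '' (chartAt E x).target := by
    rintro _ ⟨m, rfl⟩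
    have hm : m ∈ ⋃ x ∈ s, (chartAt E x).source := by rw [hcov]; exact mem_univ m
    obtain ⟨x, hx, hmx⟩ := mem_iUnion₂.1 hm
    refine mem_iUnion₂.2 ⟨x, hx, ⟨chartAt E x m, (chartAt E x).map_source hmx, ?_⟩⟩
    simp only [Function.comp_apply, (chartAt E x).left_inv hmx]
  calc dimH (range f) ≤ dimH (⋃ x ∈ s, (f ∘ (chartAt E x).symm) '' (chartAt E x).target) := dimH_mono hrange
    _ = ⨆ x ∈ s, dimH ((f ∘ (chartAt E x).symm) '' (chartAt E x).target) := dimH_bUnion hsc _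
    _ ≤ finrank ℝ E := iSup₂_le fun x _ ↦
        dimH_image_le_finrank_of_contDiffOn (chartAt E x).open_target (hf x)

/-- **A chartwise-`C¹` map from a second-countable space charted on `E` cannot fill an open set of a
bigger space**: if `range f` has non-empty interior in `F` then `finrank ℝ F ≤ finrank ℝ E`.
[cite: Mattila1995, Thm. 7.5] -/
theorem finrank_le_of_chartwise_contDiffOn_of_nonempty_interior_range [SecondCountableTopology M]
    {f : M → F} (hf : ∀ x : M, ContDiffOn ℝ 1 (f ∘ (chartAt E x).symm) (chartAt E x).target)
    (hint : (interior (range f)).Nonempty) : finrank ℝ F ≤ finrank ℝ E := by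
  have h := dimH_range_le_finrank_of_chartwise_contDiffOn hf
  rw [Real.dimH_of_nonempty_interior hint] at h
  exact_mod_cast h

/-- **An injective continuous map from a non-empty space charted on `E` into `F` forces
`dim E ≤ dim F`** (Brouwer's invariance of dimension applied to the map read in one chart, which is
continuous and injective on the open non-empty chart target). [cite: Brouwer1911Dimension, Satz 1 (p. 161)] -/
theorem finrank_le_of_injective_of_continuous_charted [Nonempty M] {f : M → F} (hf : Continuous f)
    (hinj : Function.Injective f) : finrank ℝ E ≤ finrank ℝ F := by
  obtain ⟨x⟩ := ‹Nonempty M›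
  set e := chartAt E x
  have hne : e.target.Nonempty := ⟨e x, e.map_source (mem_chart_source E x)⟩
  have hcont : ContinuousOn (f ∘ e.symm) e.target := hf.comp_continuousOn e.continuousOn_symm
  have hinj' : InjOn (f ∘ e.symm) e.target := hinj.injOn.comp e.symm.injOn e.mapsTo_symm
  exact Brouwer.finrank_le_of_injOn_of_isOpen e.open_target hne hcont hinj'

/-- **An injective continuous chartwise-`C¹` map from a non-empty second-countable space charted on `E`
whose range has non-empty interior in `F` forces `dim E = dim F`.** [cite: Brouwer1911Dimension, Satz 1 (p. 161)]
[cite: Mattila1995, Thm. 7.5] -/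
theorem finrank_eq_of_injective_of_chartwise_contDiffOn_of_nonempty_interior_range
    [SecondCountableTopology M] [Nonempty M] {f : M → F} (hcont : Continuous f)
    (hf : ∀ x : M, ContDiffOn ℝ 1 (f ∘ (chartAt E x).symm) (chartAt E x).target)
    (hinj : Function.Injective f) (hint : (interior (range f)).Nonempty) :
    finrank ℝ E = finrank ℝ F :=
  le_antisymm (finrank_le_of_injective_of_continuous_charted hcont hinj)
    (finrank_le_of_chartwise_contDiffOn_of_nonempty_interior_range hf hint)

end Charted

/-! ### Chartwise holomorphic maps on a space charted on a complex normed space -/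

section ChartedComplex

variable {E F : Type*} [NormedAddCommGroup E] [NormedSpace ℂ E] [FiniteDimensional ℂ E]
  [NormedAddCommGroup F] [NormedSpace ℂ F] [FiniteDimensional ℂ F]
  {M : Type*} [TopologicalSpace M] [ChartedSpace E M]

/-- **Complex chartwise form**: an injective continuous map `f : M → F` from a non-empty second-countable
space charted on the complex space `E`, HOLOMORPHIC in every chart (`DifferentiableOn ℂ` on the chart
targets) and whose range has non-empty interior, forces `finrank ℂ E = finrank ℂ F` — the
equal-dimension step before invariance of domain / Clements–Osgood for a holomorphic bijection between
complex manifolds read in charts. [cite: Brouwer1911Dimension, Satz 1 (p. 161)] [cite: Mattila1995, Thm. 7.5]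
[cite: HormanderSCV1973, Thm 2.2.1 and Thm 2.2.6] -/
theorem finrank_complex_eq_of_injective_of_chartwise_differentiableOn_of_nonempty_interior_range
    [SecondCountableTopology M] [Nonempty M] {f : M → F} (hcont : Continuous f)
    (hf : ∀ x : M, DifferentiableOn ℂ (f ∘ (chartAt E x).symm) (chartAt E x).target)
    (hinj : Function.Injective f) (hint : (interior (range f)).Nonempty) :
    finrank ℂ E = finrank ℂ F := by
  haveI : FiniteDimensional ℝ E := Module.Finite.trans ℂ E
  haveI : FiniteDimensional ℝ F := Module.Finite.trans ℂ F
  haveI : CompleteSpace F := FiniteDimensional.complete ℂ F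
  have hf' : ∀ x : M, ContDiffOn ℝ 1 (f ∘ (chartAt E x).symm) (chartAt E x).target := fun x ↦
    ((Literature.Analysis.Complex.SCV.analyticOnNhd_of_differentiableOn (hf x)
      (chartAt E x).open_target).contDiffOn_of_completeSpace (n := 1)).restrict_scalars ℝ
  have h := finrank_eq_of_injective_of_chartwise_contDiffOn_of_nonempty_interior_range hcont hf' hinj hint
  rw [finrank_real_of_complex, finrank_real_of_complex] at h
  omega

end ChartedComplex

end Literature.Topology.Euclidean
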